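import Mathlib
import HarnessLib
import Literature.NumberTheory.LFunctions.HallTenenbaumTheorem01
import Literature.NumberTheory.LFunctions.MertensElementary

/-!
# Rankin majorant for the capped almost-prime statistic (stub `stub_rankinMajorant`)

Line `jensen-stieltjes-majorant` of crux stmt-Parity-11327
(`Summit.Parity.BatemanHorn.Theses.AlmostPrimeZeros.LinearCappedRepulsion`).

For `s(n) = Σ_{p^v ∥ n} min(v, 2)` (in Lean `n.factorization.sum fun _ v => min v 2`,
`s(0) = s(1) = 0`) and real `y ≥ 1`, `x ≥ 3`:
`Σ_{0 ≤ n ≤ x} y^{s(n)} ≤ (x + 1)·exp(B·y·log log x + B·y^{3/2})` with `B = 8`.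

Proof (Rankin's trick with `σ = 1`, finite Euler product): `f(n) := y^{s(n)}` is nonnegative and
multiplicative with `f(1) = 1`, `f(p) = y`, `f(p^ν) = y²` (`ν ≥ 2`).  Hence
`Σ_{1 ≤ n ≤ x} f(n) ≤ x·Σ_{n ≤ x} f(n)/n ≤ x·∏_{p ≤ x} Σ_ν f(p^ν)/p^ν`
(Hall–Tenenbaum (0.4), tree: `HallTenenbaum.sum_div_le_prod_tsum`), the local factor being
`1 + y/p + (y²/p²)(1 − 1/p)⁻¹ ≤ 1 + t + 2t² ≤ e^{2t}` with `t = y/p`.  The elementary Mertens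
bound `Σ_{p ≤ x} 1/p ≤ log log x + 4` (tree: `MertensBound.sum_inv_prime_le`) gives
`∏ ≤ exp(2y·log log x + 8y)`, and `8y ≤ 8y^{3/2}`; the term `n = 0` contributes `1 ≤ exp(⋯)`.
-/

namespace Summit.Parity.BatemanHorn.Cruxes.LinearCappedRepulsion.JensenStieltjesMajorant

open Finset Real

/-- `s(p^ν) = min(ν, 2)` for a prime `p`. -/
theorem capped_prime_pow {p : ℕ} (hp : p.Prime) (ν : ℕ) :
    ((p ^ ν).factorization.sum fun _ v => min v 2) = min ν 2 := by
  rw [hp.factorization_pow, Finsupp.sum_single_index]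
  simp

/-- `s` is additive over coprime factors: `s(mn) = s(m) + s(n)` for `m ⊥ n`. -/
theorem capped_mul_of_coprime {m n : ℕ} (hmn : m.Coprime n) :
    ((m * n).factorization.sum fun _ v => min v 2) =
      (m.factorization.sum fun _ v => min v 2) + (n.factorization.sum fun _ v => min v 2) := by
  rw [Nat.factorization_mul_of_coprime hmn, Finsupp.sum_add_index_of_disjoint]
  rw [Nat.support_factorization, Nat.support_factorization]
  exact hmn.disjoint_primeFactors

/-- The local Euler factor of `n ↦ y^{s(n)}/n` at a prime `p`:
`Σ_ν y^{min(ν,2)} p^{-ν} = (y²/p²)(1 − 1/p)⁻¹ + (1 + y/p)`. -/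
theorem hasSum_localFactor {p : ℕ} (hp : p.Prime) (y : ℝ) :
    HasSum (fun ν : ℕ => y ^ (min ν 2) / (p : ℝ) ^ ν)
      (y ^ 2 / (p : ℝ) ^ 2 * (1 - 1 / (p : ℝ))⁻¹ + (1 + y / p)) := by
  have hp0 : (0 : ℝ) < p := by exact_mod_cast hp.pos
  have hp1 : (1 : ℝ) < p := by exact_mod_cast hp.one_lt
  have hr0 : (0 : ℝ) ≤ 1 / p := by positivity
  have hr1 : 1 / (p : ℝ) < 1 := (div_lt_one hp0).mpr hp1
  have hgeom := (hasSum_geometric_of_lt_one hr0 hr1).mul_left (y ^ 2 / (p : ℝ) ^ 2)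
  have hfun : (fun ν : ℕ => y ^ (min (ν + 2) 2) / (p : ℝ) ^ (ν + 2))
      = fun ν : ℕ => y ^ 2 / (p : ℝ) ^ 2 * (1 / (p : ℝ)) ^ ν := by
    funext ν
    rw [show min (ν + 2) 2 = 2 by omega, pow_add, one_div_pow]
    field_simp
  have hshift : HasSum (fun ν : ℕ => y ^ (min (ν + 2) 2) / (p : ℝ) ^ (ν + 2))
      (y ^ 2 / (p : ℝ) ^ 2 * (1 - 1 / (p : ℝ))⁻¹) := by
    rw [hfun]
    exact hgeom
  rw [show (1 : ℝ) + y / p = ∑ i ∈ Finset.range 2, y ^ (min i 2) / (p : ℝ) ^ i by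
    simp [Finset.sum_range_succ]]
  exact (hasSum_nat_add_iff 2).mp hshift

/-- The local factor is at most `exp(2y/p)` (`y ≥ 0`): with `t = y/p`,
`(y²/p²)(1 − 1/p)⁻¹ + 1 + t ≤ 1 + t + 2t² ≤ 1 + 2t + (2t)²/2 ≤ e^{2t}`. -/
theorem tsum_localFactor_le {p : ℕ} (hp : p.Prime) {y : ℝ} (hy : 0 ≤ y) :
    ∑' ν : ℕ, y ^ (min ν 2) / (p : ℝ) ^ ν ≤ Real.exp (2 * y / p) := by
  rw [(hasSum_localFactor hp y).tsum_eq]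
  have hp0 : (0 : ℝ) < p := by exact_mod_cast hp.pos
  have hp2 : (2 : ℝ) ≤ p := by exact_mod_cast hp.two_le
  set t : ℝ := y / (p : ℝ) with ht
  have ht0 : 0 ≤ t := div_nonneg hy hp0.le
  have hip : 1 / (p : ℝ) ≤ 1 / 2 := one_div_le_one_div_of_le two_pos hp2
  have hpos : 0 < 1 - 1 / (p : ℝ) := by linarith
  have hinv : (1 - 1 / (p : ℝ))⁻¹ ≤ 2 := by
    rw [inv_eq_one_div, div_le_iff₀ hpos]
    linarith
  have hsq : y ^ 2 / (p : ℝ) ^ 2 = t ^ 2 := by rw [ht, div_pow]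
  have h2t : 2 * y / p = 2 * t := by rw [ht]; ring
  have hexp : 1 + 2 * t + (2 * t) ^ 2 / 2 ≤ Real.exp (2 * t) :=
    Real.quadratic_le_exp_of_nonneg (by positivity)
  rw [h2t, hsq]
  have ht2 : 0 ≤ t ^ 2 := sq_nonneg t
  calc t ^ 2 * (1 - 1 / (p : ℝ))⁻¹ + (1 + t) ≤ t ^ 2 * 2 + (1 + t) := by gcongr
    _ ≤ 1 + 2 * t + (2 * t) ^ 2 / 2 := by nlinarith
    _ ≤ Real.exp (2 * t) := hexp

/-- `1 < log 3` (since `e < 2.72 < 3`), whence `0 ≤ log log x` for `x ≥ 3`. -/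
theorem loglog_nonneg {x : ℝ} (hx : 3 ≤ x) : 0 ≤ Real.log (Real.log x) := by
  have h3 : 1 < Real.log 3 := by
    rw [Real.lt_log_iff_exp_lt (by norm_num)]
    have := Real.exp_one_lt_d9
    linarith
  have hx' : Real.log 3 ≤ Real.log x := Real.log_le_log (by norm_num) hx
  exact Real.log_nonneg (by linarith)

/-- **Stub `stub_rankinMajorant`** (elementary global majorant of the almost-prime polynomial on
the positive real axis, Rankin's trick + Mertens): there is `B ≥ 0` (here `B = 8`) such that for
all `x ≥ 3` and real `y ≥ 1`,
`Σ_{0 ≤ n ≤ x} y^{s(n)} ≤ (x + 1)·exp(B·y·log log x + B·y^{3/2})`,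
`s(n) = Σ_{p^v ∥ n} min(v, 2)`. -/
theorem stub_rankinMajorant :
    ∃ B : ℝ, 0 ≤ B ∧ ∀ x : ℕ, 3 ≤ x → ∀ y : ℝ, 1 ≤ y →
      ∑ n ∈ Finset.range (x + 1), y ^ (n.factorization.sum fun _ v => min v 2) ≤
        ((x : ℝ) + 1) * Real.exp (B * y * Real.log (Real.log x) + B * y ^ (3 / 2 : ℝ)) := by
  refine ⟨8, by norm_num, fun x hx y hy => ?_⟩
  set f : ℕ → ℝ := fun n => y ^ (n.factorization.sum fun _ v => min v 2) with hf
  have hy0 : 0 ≤ y := by linarith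
  have hf0 : ∀ n, 0 ≤ f n := fun n => pow_nonneg hy0 _
  have hf1 : f 1 = 1 := by simp [hf]
  have hfz : f 0 = 1 := by simp [hf]
  have hmul : ∀ m n, Nat.Coprime m n → f (m * n) = f m * f n := by
    intro m n hmn
    simp only [hf]
    rw [capped_mul_of_coprime hmn, pow_add]
  have hfpow : ∀ {p : ℕ}, p.Prime → ∀ ν : ℕ, f (p ^ ν) = y ^ (min ν 2) := by
    intro p hp ν
    simp only [hf]
    rw [capped_prime_pow hp]
  have hfun : ∀ {p : ℕ}, p.Prime →
      (fun ν : ℕ => f (p ^ ν) / (p : ℝ) ^ ν) = fun ν : ℕ => y ^ (min ν 2) / (p : ℝ) ^ ν := by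
    intro p hp
    funext ν
    rw [hfpow hp]
  have hsum : ∀ p : ℕ, p.Prime → Summable (fun ν : ℕ => f (p ^ ν) / (p : ℝ) ^ ν) := by
    intro p hp
    rw [hfun hp]
    exact (hasSum_localFactor hp y).summable
  -- the quantities
  have hx3 : (3 : ℝ) ≤ x := by exact_mod_cast hx
  have hx0 : (0 : ℝ) ≤ x := by positivity
  have hL : 0 ≤ Real.log (Real.log x) := loglog_nonneg hx3
  set L : ℝ := Real.log (Real.log x) with hLdef
  -- Mertens, elementary form
  have hM : ∑ p ∈ Nat.primesLE x, (1 : ℝ) / p ≤ L + 4 :=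
    Literature.NumberTheory.LFunctions.MertensBound.sum_inv_prime_le x (by omega)
  -- the Euler product bound
  have hprod : ∏ p ∈ Nat.primesLE x, ∑' ν : ℕ, f (p ^ ν) / (p : ℝ) ^ ν ≤
      Real.exp (2 * y * (L + 4)) := by
    have hmem : ∀ p ∈ Nat.primesLE x, p.Prime := fun p hp => (Nat.mem_primesLE.mp hp).2
    calc ∏ p ∈ Nat.primesLE x, ∑' ν : ℕ, f (p ^ ν) / (p : ℝ) ^ ν
        ≤ ∏ p ∈ Nat.primesLE x, Real.exp (2 * y / p) := by
          refine Finset.prod_le_prod (fun p _ => tsum_nonneg fun ν => ?_) fun p hp => ?_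
          · exact div_nonneg (hf0 _) (pow_nonneg (Nat.cast_nonneg _) _)
          · rw [hfun (hmem p hp)]
            exact tsum_localFactor_le (hmem p hp) hy0
      _ = Real.exp (∑ p ∈ Nat.primesLE x, 2 * y / p) := (Real.exp_sum _ _).symm
      _ ≤ Real.exp (2 * y * (L + 4)) := by
          refine Real.exp_le_exp.mpr ?_
          have e : ∑ p ∈ Nat.primesLE x, 2 * y / (p : ℝ)
              = 2 * y * ∑ p ∈ Nat.primesLE x, (1 : ℝ) / p := by
            rw [Finset.mul_sum]
            refine Finset.sum_congr rfl fun p _ => ?_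
            ring
          rw [e]
          exact mul_le_mul_of_nonneg_left hM (by positivity)
  -- Rankin: `Σ_{1 ≤ n ≤ x} f(n) ≤ x Σ f(n)/n ≤ x ∏ ⋯`
  have hIcc : ∑ n ∈ Icc 1 x, f n ≤ x * Real.exp (2 * y * (L + 4)) := by
    calc ∑ n ∈ Icc 1 x, f n ≤ ∑ n ∈ Icc 1 x, (x : ℝ) * (f n / n) := by
          refine Finset.sum_le_sum fun n hn => ?_
          have hn1 : (1 : ℝ) ≤ n := by exact_mod_cast (Finset.mem_Icc.mp hn).1
          have hnx : (n : ℝ) ≤ x := by exact_mod_cast (Finset.mem_Icc.mp hn).2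
          have hn0 : (0 : ℝ) < n := by linarith
          calc f n = (n : ℝ) * (f n / n) := by field_simp
            _ ≤ (x : ℝ) * (f n / n) :=
                mul_le_mul_of_nonneg_right hnx (div_nonneg (hf0 n) hn0.le)
      _ = x * ∑ n ∈ Icc 1 x, f n / n := by rw [Finset.mul_sum]
      _ ≤ x * ∏ p ∈ Nat.primesLE x, ∑' ν : ℕ, f (p ^ ν) / (p : ℝ) ^ ν :=
          mul_le_mul_of_nonneg_left
            (Literature.NumberTheory.LFunctions.HallTenenbaum.sum_div_le_prod_tsum
              hf1 hmul hf0 hsum x) hx0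
      _ ≤ x * Real.exp (2 * y * (L + 4)) := mul_le_mul_of_nonneg_left hprod hx0
  -- the exponent comparison `2y(L + 4) ≤ 8yL + 8y^{3/2}`
  have hE : Real.exp (2 * y * (L + 4)) ≤ Real.exp (8 * y * L + 8 * y ^ (3 / 2 : ℝ)) := by
    refine Real.exp_le_exp.mpr ?_
    have h1 : y ≤ y ^ (3 / 2 : ℝ) := Real.self_le_rpow_of_one_le hy (by norm_num)
    have h2 : 0 ≤ y * L := mul_nonneg hy0 hL
    nlinarith
  have hE1 : 1 ≤ Real.exp (8 * y * L + 8 * y ^ (3 / 2 : ℝ)) := by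
    refine Real.one_le_exp ?_
    have : 0 ≤ y ^ (3 / 2 : ℝ) := Real.rpow_nonneg hy0 _
    positivity
  -- assemble: the `n = 0` term is `1`
  have hsplit : ∑ n ∈ Finset.range (x + 1), f n = f 0 + ∑ n ∈ Icc 1 x, f n := by
    rw [Finset.sum_range_eq_add_Ico f (by omega), Finset.Ico_add_one_right_eq_Icc]
  change ∑ n ∈ Finset.range (x + 1), f n ≤ _
  rw [hsplit, hfz]
  calc 1 + ∑ n ∈ Icc 1 x, f n ≤ 1 + x * Real.exp (2 * y * (L + 4)) := by linarith
    _ ≤ Real.exp (8 * y * L + 8 * y ^ (3 / 2 : ℝ))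
        + x * Real.exp (8 * y * L + 8 * y ^ (3 / 2 : ℝ)) := by
          gcongr
    _ = ((x : ℝ) + 1) * Real.exp (8 * y * L + 8 * y ^ (3 / 2 : ℝ)) := by ring

end Summit.Parity.BatemanHorn.Cruxes.LinearCappedRepulsion.JensenStieltjesMajorant
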